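import Mathlib
import Summits.KontsevichZagierPeriods.KontsevichZagierPeriods.Theorems.InverseLandauTateFamilyKernelIsotopyTwo
import Summits.KontsevichZagierPeriods.KontsevichZagierPeriods.Theorems.InverseLandauTateFamilyKernelStubJacClass

/-!
# `TateFamilyKernel` — the JAC (torus pull-back) element of dimension 2 inhabits the Tate descent
# normal form (line `Sketch`, stub `stub_descentOfJac2`)

Crux `TateFamilyKernel` (stmt-KontsevichZagierPeriods-9130, route `InverseLandau`), line `Sketch`.
CONSTRUCTOR: a Tate family `P/Q` of dimension `2` (`N = 0`) whose fibre at the real-algebraic `ϖ₀`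
is the JAC element `h(Q₁, Q₂, ϖ₀)·Jac(Q₁, Q₂)` (`h = Bh/Eh`; `Q₁ ≡ κ₁` on the `w₀`-faces, `Q₂ ≡ κ₂`
on the `w₁`-faces; `Eh ∘ Φ_s ≠ 0` along the straight-line family
`Φ_s = ((1 − s)κ₁ + sQ₁, (1 − s)κ₂ + sQ₂)`) satisfies the `∃` block of the research stub
`stub_descentTate 0` with ONE auxiliary cube variable (`m = 1`) and kind (a) only (`K = 3`,
`L = J = 0`, all kind-(d)/(e) families empty). The three Ayoub elements are the certificate of
`stub_isotopyTwo`: on the 3-cube `(w₀, w₁, s) = (X 0, X 1, X 2)` (`ϖ = X 3`,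
`φᵢ = κᵢ + s(Qᵢ − κᵢ)` re-indexed by `ι = ![0, 1, 3]`, `BΦ = Bh ∘ Φ`, `EΦ = Eh ∘ Φ`)
`A₀ = −BΦ(∂₁φ₁∂₂φ₂ − ∂₂φ₁∂₁φ₂)` in direction `w₀`, `A₁ = BΦ(∂₀φ₁∂₂φ₂ − ∂₂φ₁∂₀φ₂)` in direction
`w₁`, `A₂ = −BΦ·J` in direction `s`, `J = ∂₀φ₁∂₁φ₂ − ∂₁φ₁∂₀φ₂ = s²·Jac` (`JacClass.jacobian_line`),
common denominator `EΦ`.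

Pointwise on `[0,1]³`: the three Griffiths parts sum to zero (`Iso.transport`: the pulled-back
2-form `Φ^*(h dy₀ ∧ dy₁)` is closed); `A₀/EΦ` vanishes on `w₀ ∈ {0,1}` and `A₁/EΦ` on `w₁ ∈ {0,1}`
(these faces go to the lines `y₀ = κ₁`, `y₁ = κ₂`, so the tangential derivatives of `φ₁`, `φ₂`
vanish there); `A₂/EΦ = −h(Φ_s)·s²·Jac` is `−P/Q` at `s = 1` (the fibre identity) and `0` at
`s = 0`. Hence `Σ_k [Griffiths_k − face¹_k + face⁰_k] = P/Q`. No named fact, no new definition.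
References: Kontsevich–Zagier 2001 §1.2 rules (2), (3); Ayoub, EMS Newsl. 91 (2014) Def. 10.
-/

noncomputable section

open MeasureTheory Set MvPolynomial
open Literature.NumberTheory.Transcendental

namespace Summit.KontsevichZagierPeriods.InverseLandau.TateFamilyKernel.Descent

namespace DescentOfJac2

open Iso JacClass

/-! ### The common denominator `Eh ∘ Φ` on the closed 3-cube -/

/-- `Eh ∘ Φ_s ≠ 0` on the closed cube `[0,1]³` at `ϖ₀`: the hypothesis along the straight segments,
read at `s = w₂` (`JacClass.aeval_bind₁_line`). [folklore] -/
theorem denom_ne {ι : Fin (2 + 1) → Fin (2 + 1 + 1)} (hι : ι = ![0, 1, 3])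
    {Q₁ Q₂ Eh : MvPolynomial (Fin (2 + 1)) ℚ} {κ₁ κ₂ : ℚ}
    {φ₁ φ₂ EΦ : MvPolynomial (Fin (2 + 1 + 1)) ℚ}
    (hφ₁ : φ₁ = C κ₁ + X 2 * (rename ι Q₁ - C κ₁)) (hφ₂ : φ₂ = C κ₂ + X 2 * (rename ι Q₂ - C κ₂))
    (hEΦ : EΦ = bind₁ ![φ₁, φ₂, X 3] Eh) (ϖ₀ : ℝ)
    (hEh : ∀ w ∈ KZ.cube 2, ∀ s ∈ Icc (0 : ℝ) 1,
      aeval (Fin.snoc (![(1 - s) * κ₁ + s * aeval (Fin.snoc w ϖ₀ : Fin (2 + 1) → ℝ) Q₁,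
          (1 - s) * κ₂ + s * aeval (Fin.snoc w ϖ₀ : Fin (2 + 1) → ℝ) Q₂] : Fin 2 → ℝ) ϖ₀ :
        Fin (2 + 1) → ℝ) Eh ≠ 0)
    (w : Fin (2 + 1) → ℝ) (hw : w ∈ KZ.cube (2 + 1)) :
    aeval (Fin.snoc w ϖ₀ : Fin (2 + 1 + 1) → ℝ) EΦ ≠ 0 := by
  subst hφ₁ hφ₂ hEΦ
  obtain ⟨z, c, rfl⟩ : ∃ (z : Fin 2 → ℝ) (c : ℝ), (Fin.snoc z c : Fin (2 + 1) → ℝ) = w :=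
    ⟨Fin.init w, w (Fin.last 2), Fin.snoc_init_self w⟩
  obtain ⟨hz, hc0, hc1⟩ := KZ.snoc_mem_cube_iff.1 hw
  rw [aeval_bind₁_line hι]
  exact hEh z hz c ⟨hc0, hc1⟩

/-! ### Face values of the certificate -/

/-- On the faces `w₀ ∈ {0, 1}` the first component `φ₁ = κ₁ + s(Q₁ − κ₁)` is constant (`Q₁ ≡ κ₁`
there, `JacClass.face_transfer`), so its tangential derivatives `∂₁φ₁`, `∂₂φ₁` vanish on the face
(`Iso.aeval_pderiv_eq_zero_of_eq`) and with them `A₀ = −BΦ(∂₁φ₁∂₂φ₂ − ∂₂φ₁∂₁φ₂)`. [folklore] -/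
theorem aeval_A₀_face {ι : Fin (2 + 1) → Fin (2 + 1 + 1)} (hι : ι = ![0, 1, 3])
    {Q₁ : MvPolynomial (Fin (2 + 1)) ℚ} {κ₁ : ℚ} {φ₁ φ₂ BΦ A₀ : MvPolynomial (Fin (2 + 1 + 1)) ℚ}
    (hφ₁ : φ₁ = C κ₁ + X 2 * (rename ι Q₁ - C κ₁))
    (h10 : ∃ R : MvPolynomial (Fin (2 + 1)) ℚ, Q₁ = C κ₁ + X 0 * R)
    (h11 : ∃ R : MvPolynomial (Fin (2 + 1)) ℚ, Q₁ = C κ₁ + (1 - X 0) * R)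
    (hA₀ : A₀ = -(BΦ * (pderiv 1 φ₁ * pderiv 2 φ₂ - pderiv 2 φ₁ * pderiv 1 φ₂)))
    (w : Fin (2 + 1) → ℝ) (ϖ₀ : ℝ) {β : ℝ} (hβ : β = 0 ∨ β = 1) :
    aeval (Fin.snoc (Function.update w 0 β) ϖ₀ : Fin (2 + 1 + 1) → ℝ) A₀ = 0 := by
  obtain ⟨R, hR⟩ := h10
  obtain ⟨R', hR'⟩ := h11
  -- the face factorisations of `Q₁` transfer to `φ₁`
  have hf : φ₁ = C κ₁ + X 0 * (X 2 * rename ι R) := by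
    rw [hφ₁, face_transfer ι hR, rename_X, iota_zero hι]
  have hf' : φ₁ = C κ₁ + (1 - X 0) * (X 2 * rename ι R') := by
    rw [hφ₁, face_transfer ι hR', map_sub, map_one, rename_X, iota_zero hι]
  have hd1 : pderiv (1 : Fin (2 + 1 + 1)) (X 0 : MvPolynomial (Fin (2 + 1 + 1)) ℚ) = 0 :=
    pderiv_X_of_ne (by decide)
  have hd2 : pderiv (2 : Fin (2 + 1 + 1)) (X 0 : MvPolynomial (Fin (2 + 1 + 1)) ℚ) = 0 :=
    pderiv_X_of_ne (by decide)
  have hd1' : pderiv (1 : Fin (2 + 1 + 1)) (1 - X 0 : MvPolynomial (Fin (2 + 1 + 1)) ℚ) = 0 := by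
    rw [map_sub, pderiv_one, hd1, sub_zero]
  have hd2' : pderiv (2 : Fin (2 + 1 + 1)) (1 - X 0 : MvPolynomial (Fin (2 + 1 + 1)) ℚ) = 0 := by
    rw [map_sub, pderiv_one, hd2, sub_zero]
  -- the tangential derivatives of `φ₁` vanish on the face
  have h : aeval (Fin.snoc (Function.update w 0 β) ϖ₀ : Fin (2 + 1 + 1) → ℝ) (pderiv 1 φ₁) = 0 ∧
      aeval (Fin.snoc (Function.update w 0 β) ϖ₀ : Fin (2 + 1 + 1) → ℝ) (pderiv 2 φ₁) = 0 := by
    rcases hβ with rfl | rfl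
    · have hv : aeval (Fin.snoc (Function.update w 0 (0 : ℝ)) ϖ₀ : Fin (2 + 1 + 1) → ℝ)
          (X 0 : MvPolynomial (Fin (2 + 1 + 1)) ℚ) = 0 := by
        rw [aeval_X, Gap.snoc4_0, Function.update_self]
      exact ⟨aeval_pderiv_eq_zero_of_eq hf hd1 hv, aeval_pderiv_eq_zero_of_eq hf hd2 hv⟩
    · have hv : aeval (Fin.snoc (Function.update w 0 (1 : ℝ)) ϖ₀ : Fin (2 + 1 + 1) → ℝ)
          (1 - X 0 : MvPolynomial (Fin (2 + 1 + 1)) ℚ) = 0 := by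
        rw [map_sub, map_one, aeval_X, Gap.snoc4_0, Function.update_self, sub_self]
      exact ⟨aeval_pderiv_eq_zero_of_eq hf' hd1' hv, aeval_pderiv_eq_zero_of_eq hf' hd2' hv⟩
  simp only [hA₀, map_neg, map_mul, map_sub, h.1, h.2, zero_mul, sub_zero, mul_zero, neg_zero]

/-- On the faces `w₁ ∈ {0, 1}` the second component `φ₂ = κ₂ + s(Q₂ − κ₂)` is constant, so
`∂₀φ₂`, `∂₂φ₂` vanish on the face and with them `A₁ = BΦ(∂₀φ₁∂₂φ₂ − ∂₂φ₁∂₀φ₂)`. [folklore] -/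
theorem aeval_A₁_face {ι : Fin (2 + 1) → Fin (2 + 1 + 1)} (hι : ι = ![0, 1, 3])
    {Q₂ : MvPolynomial (Fin (2 + 1)) ℚ} {κ₂ : ℚ} {φ₁ φ₂ BΦ A₁ : MvPolynomial (Fin (2 + 1 + 1)) ℚ}
    (hφ₂ : φ₂ = C κ₂ + X 2 * (rename ι Q₂ - C κ₂))
    (h20 : ∃ R : MvPolynomial (Fin (2 + 1)) ℚ, Q₂ = C κ₂ + X 1 * R)
    (h21 : ∃ R : MvPolynomial (Fin (2 + 1)) ℚ, Q₂ = C κ₂ + (1 - X 1) * R)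
    (hA₁ : A₁ = BΦ * (pderiv 0 φ₁ * pderiv 2 φ₂ - pderiv 2 φ₁ * pderiv 0 φ₂))
    (w : Fin (2 + 1) → ℝ) (ϖ₀ : ℝ) {β : ℝ} (hβ : β = 0 ∨ β = 1) :
    aeval (Fin.snoc (Function.update w 1 β) ϖ₀ : Fin (2 + 1 + 1) → ℝ) A₁ = 0 := by
  obtain ⟨R, hR⟩ := h20
  obtain ⟨R', hR'⟩ := h21
  have hf : φ₂ = C κ₂ + X 1 * (X 2 * rename ι R) := by
    rw [hφ₂, face_transfer ι hR, rename_X, iota_one hι]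
  have hf' : φ₂ = C κ₂ + (1 - X 1) * (X 2 * rename ι R') := by
    rw [hφ₂, face_transfer ι hR', map_sub, map_one, rename_X, iota_one hι]
  have hd0 : pderiv (0 : Fin (2 + 1 + 1)) (X 1 : MvPolynomial (Fin (2 + 1 + 1)) ℚ) = 0 :=
    pderiv_X_of_ne (by decide)
  have hd2 : pderiv (2 : Fin (2 + 1 + 1)) (X 1 : MvPolynomial (Fin (2 + 1 + 1)) ℚ) = 0 :=
    pderiv_X_of_ne (by decide)
  have hd0' : pderiv (0 : Fin (2 + 1 + 1)) (1 - X 1 : MvPolynomial (Fin (2 + 1 + 1)) ℚ) = 0 := by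
    rw [map_sub, pderiv_one, hd0, sub_zero]
  have hd2' : pderiv (2 : Fin (2 + 1 + 1)) (1 - X 1 : MvPolynomial (Fin (2 + 1 + 1)) ℚ) = 0 := by
    rw [map_sub, pderiv_one, hd2, sub_zero]
  have h : aeval (Fin.snoc (Function.update w 1 β) ϖ₀ : Fin (2 + 1 + 1) → ℝ) (pderiv 0 φ₂) = 0 ∧
      aeval (Fin.snoc (Function.update w 1 β) ϖ₀ : Fin (2 + 1 + 1) → ℝ) (pderiv 2 φ₂) = 0 := by
    rcases hβ with rfl | rfl
    · have hv : aeval (Fin.snoc (Function.update w 1 (0 : ℝ)) ϖ₀ : Fin (2 + 1 + 1) → ℝ)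
          (X 1 : MvPolynomial (Fin (2 + 1 + 1)) ℚ) = 0 := by
        rw [aeval_X, Gap.snoc4_1, Function.update_self]
      exact ⟨aeval_pderiv_eq_zero_of_eq hf hd0 hv, aeval_pderiv_eq_zero_of_eq hf hd2 hv⟩
    · have hv : aeval (Fin.snoc (Function.update w 1 (1 : ℝ)) ϖ₀ : Fin (2 + 1 + 1) → ℝ)
          (1 - X 1 : MvPolynomial (Fin (2 + 1 + 1)) ℚ) = 0 := by
        rw [map_sub, map_one, aeval_X, Gap.snoc4_1, Function.update_self, sub_self]
      exact ⟨aeval_pderiv_eq_zero_of_eq hf' hd0' hv, aeval_pderiv_eq_zero_of_eq hf' hd2' hv⟩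
  simp only [hA₁, map_mul, map_sub, h.1, h.2, mul_zero, sub_zero]

/-- At the end `s = 1` of the straight-line family, `A₂ = −BΦ·J` evaluates to
`−Bh(Q₁, Q₂, ϖ₀)·Jac(Q₁, Q₂)` (`J = s²·Jac`, `Φ₁ = (Q₁, Q₂)`). [folklore] -/
theorem aeval_A₂_one {ι : Fin (2 + 1) → Fin (2 + 1 + 1)} (hι : ι = ![0, 1, 3])
    {Q₁ Q₂ Bh : MvPolynomial (Fin (2 + 1)) ℚ} {κ₁ κ₂ : ℚ}
    {φ₁ φ₂ A₂ : MvPolynomial (Fin (2 + 1 + 1)) ℚ}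
    (hφ₁ : φ₁ = C κ₁ + X 2 * (rename ι Q₁ - C κ₁)) (hφ₂ : φ₂ = C κ₂ + X 2 * (rename ι Q₂ - C κ₂))
    (hA₂ : A₂ = -(bind₁ ![φ₁, φ₂, X 3] Bh *
      (pderiv 0 φ₁ * pderiv 1 φ₂ - pderiv 1 φ₁ * pderiv 0 φ₂)))
    (z : Fin 2 → ℝ) (ϖ₀ : ℝ) :
    aeval (Fin.snoc (Fin.snoc z 1 : Fin (2 + 1) → ℝ) ϖ₀ : Fin (2 + 1 + 1) → ℝ) A₂ =
      -(aeval (Fin.snoc (![aeval (Fin.snoc z ϖ₀ : Fin (2 + 1) → ℝ) Q₁,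
            aeval (Fin.snoc z ϖ₀ : Fin (2 + 1) → ℝ) Q₂] : Fin 2 → ℝ) ϖ₀ : Fin (2 + 1) → ℝ) Bh *
        aeval (Fin.snoc z ϖ₀ : Fin (2 + 1) → ℝ)
          (pderiv 0 Q₁ * pderiv 1 Q₂ - pderiv 1 Q₁ * pderiv 0 Q₂)) := by
  subst hφ₁ hφ₂ hA₂
  rw [jacobian_line hι]
  simp only [map_neg, map_mul, map_pow, aeval_X, aeval_rename_iota hι, aeval_bind₁_line_one hι,
    Gap.snoc4_2, Gap.snoc3_2]
  ring

/-- At the end `s = 0` of the straight-line family `A₂ = −BΦ·J` vanishes (`J = s²·Jac`).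
[folklore] -/
theorem aeval_A₂_zero {ι : Fin (2 + 1) → Fin (2 + 1 + 1)} (hι : ι = ![0, 1, 3])
    {Q₁ Q₂ : MvPolynomial (Fin (2 + 1)) ℚ} {κ₁ κ₂ : ℚ}
    {φ₁ φ₂ BΦ A₂ : MvPolynomial (Fin (2 + 1 + 1)) ℚ}
    (hφ₁ : φ₁ = C κ₁ + X 2 * (rename ι Q₁ - C κ₁)) (hφ₂ : φ₂ = C κ₂ + X 2 * (rename ι Q₂ - C κ₂))
    (hA₂ : A₂ = -(BΦ * (pderiv 0 φ₁ * pderiv 1 φ₂ - pderiv 1 φ₁ * pderiv 0 φ₂)))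
    (z : Fin 2 → ℝ) (ϖ₀ : ℝ) :
    aeval (Fin.snoc (Fin.snoc z 0 : Fin (2 + 1) → ℝ) ϖ₀ : Fin (2 + 1 + 1) → ℝ) A₂ = 0 := by
  subst hφ₁ hφ₂ hA₂
  rw [jacobian_line hι]
  simp only [map_neg, map_mul, map_pow, aeval_X, Gap.snoc4_2, Gap.snoc3_2]
  ring

/-- At the end `s = 1` the common denominator `EΦ = Eh ∘ Φ` evaluates to `Eh(Q₁, Q₂, ϖ₀)`.
[folklore] -/
theorem aeval_EΦ_one {ι : Fin (2 + 1) → Fin (2 + 1 + 1)} (hι : ι = ![0, 1, 3])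
    {Q₁ Q₂ Eh : MvPolynomial (Fin (2 + 1)) ℚ} {κ₁ κ₂ : ℚ}
    {φ₁ φ₂ : MvPolynomial (Fin (2 + 1 + 1)) ℚ}
    (hφ₁ : φ₁ = C κ₁ + X 2 * (rename ι Q₁ - C κ₁)) (hφ₂ : φ₂ = C κ₂ + X 2 * (rename ι Q₂ - C κ₂))
    (z : Fin 2 → ℝ) (ϖ₀ : ℝ) :
    aeval (Fin.snoc (Fin.snoc z 1 : Fin (2 + 1) → ℝ) ϖ₀ : Fin (2 + 1 + 1) → ℝ)
        (bind₁ ![φ₁, φ₂, X 3] Eh) =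
      aeval (Fin.snoc (![aeval (Fin.snoc z ϖ₀ : Fin (2 + 1) → ℝ) Q₁,
          aeval (Fin.snoc z ϖ₀ : Fin (2 + 1) → ℝ) Q₂] : Fin 2 → ℝ) ϖ₀ : Fin (2 + 1) → ℝ) Eh := by
  subst hφ₁ hφ₂
  exact aeval_bind₁_line_one hι z ϖ₀ Q₁ Q₂ Eh κ₁ κ₂

/-! ### The pointwise certificate identity on `[0,1]³` -/

/-- **The kind-(a) identity.** For `w = (w₀, w₁, s) ∈ [0,1]³`, the three Ayoub elements of
`(A₀, EΦ, w₀)`, `(A₁, EΦ, w₁)`, `(A₂, EΦ, s)` sum to `(P/Q)(w₀, w₁, ϖ₀)`: the Griffiths parts sum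
to zero (`Iso.transport`), the faces of `A₀/EΦ`, `A₁/EΦ` vanish, and the `s`-faces of
`A₂/EΦ = −h(Φ_s)·J_s` are `−P/Q` (`s = 1`, the fibre identity `hfib`) and `0` (`s = 0`).
[folklore] -/
theorem pointwise {ι : Fin (2 + 1) → Fin (2 + 1 + 1)} (hι : ι = ![0, 1, 3])
    {Q₁ Q₂ Bh Eh : MvPolynomial (Fin (2 + 1)) ℚ} {κ₁ κ₂ : ℚ}
    {φ₁ φ₂ BΦ EΦ : MvPolynomial (Fin (2 + 1 + 1)) ℚ} {A : Fin 3 → MvPolynomial (Fin (2 + 1 + 1)) ℚ}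
    {i : Fin 3 → Fin (2 + 1)}
    (hφ₁ : φ₁ = C κ₁ + X 2 * (rename ι Q₁ - C κ₁)) (hφ₂ : φ₂ = C κ₂ + X 2 * (rename ι Q₂ - C κ₂))
    (hBΦ : BΦ = bind₁ ![φ₁, φ₂, X 3] Bh) (hEΦ : EΦ = bind₁ ![φ₁, φ₂, X 3] Eh)
    (hA : A = ![-(BΦ * (pderiv 1 φ₁ * pderiv 2 φ₂ - pderiv 2 φ₁ * pderiv 1 φ₂)),
      BΦ * (pderiv 0 φ₁ * pderiv 2 φ₂ - pderiv 2 φ₁ * pderiv 0 φ₂),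
      -(BΦ * (pderiv 0 φ₁ * pderiv 1 φ₂ - pderiv 1 φ₁ * pderiv 0 φ₂))])
    (hi : i = ![0, 1, 2])
    (h10 : ∃ R : MvPolynomial (Fin (2 + 1)) ℚ, Q₁ = C κ₁ + X 0 * R)
    (h11 : ∃ R : MvPolynomial (Fin (2 + 1)) ℚ, Q₁ = C κ₁ + (1 - X 0) * R)
    (h20 : ∃ R : MvPolynomial (Fin (2 + 1)) ℚ, Q₂ = C κ₂ + X 1 * R)
    (h21 : ∃ R : MvPolynomial (Fin (2 + 1)) ℚ, Q₂ = C κ₂ + (1 - X 1) * R)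
    (P Q : MvPolynomial (Fin (2 + 1)) ℚ) (ϖ₀ : ℝ)
    (hfib : ∀ w ∈ KZ.cube 2,
      aeval (Fin.snoc w ϖ₀ : Fin (2 + 1) → ℝ) P / aeval (Fin.snoc w ϖ₀ : Fin (2 + 1) → ℝ) Q =
        aeval (Fin.snoc (![aeval (Fin.snoc w ϖ₀ : Fin (2 + 1) → ℝ) Q₁,
            aeval (Fin.snoc w ϖ₀ : Fin (2 + 1) → ℝ) Q₂] : Fin 2 → ℝ) ϖ₀ : Fin (2 + 1) → ℝ) Bh /
          aeval (Fin.snoc (![aeval (Fin.snoc w ϖ₀ : Fin (2 + 1) → ℝ) Q₁,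
            aeval (Fin.snoc w ϖ₀ : Fin (2 + 1) → ℝ) Q₂] : Fin 2 → ℝ) ϖ₀ : Fin (2 + 1) → ℝ) Eh *
          aeval (Fin.snoc w ϖ₀ : Fin (2 + 1) → ℝ)
            (pderiv 0 Q₁ * pderiv 1 Q₂ - pderiv 1 Q₁ * pderiv 0 Q₂))
    (w : Fin (2 + 1) → ℝ) (hw : w ∈ KZ.cube (2 + 1)) :
    aeval (Fin.snoc (fun t => w (Fin.castAdd 1 t)) ϖ₀ : Fin (2 + 1) → ℝ) P /
        aeval (Fin.snoc (fun t => w (Fin.castAdd 1 t)) ϖ₀ : Fin (2 + 1) → ℝ) Q =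
      ∑ k : Fin 3,
        (aeval (Fin.snoc w ϖ₀ : Fin (2 + 1 + 1) → ℝ)
            (pderiv (Fin.castSucc (i k)) (A k) * EΦ - A k * pderiv (Fin.castSucc (i k)) EΦ) /
          aeval (Fin.snoc w ϖ₀ : Fin (2 + 1 + 1) → ℝ) (EΦ ^ 2)
        - aeval (Fin.snoc (Function.update w (i k) 1) ϖ₀ : Fin (2 + 1 + 1) → ℝ) (A k) /
            aeval (Fin.snoc (Function.update w (i k) 1) ϖ₀ : Fin (2 + 1 + 1) → ℝ) EΦ
        + aeval (Fin.snoc (Function.update w (i k) 0) ϖ₀ : Fin (2 + 1 + 1) → ℝ) (A k) /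
            aeval (Fin.snoc (Function.update w (i k) 0) ϖ₀ : Fin (2 + 1 + 1) → ℝ) EΦ) := by
  subst hi hBΦ hEΦ
  -- the components of the certificate
  obtain ⟨hA0, hA1, hA2⟩ :
      A 0 = -(bind₁ ![φ₁, φ₂, X 3] Bh * (pderiv 1 φ₁ * pderiv 2 φ₂ - pderiv 2 φ₁ * pderiv 1 φ₂)) ∧
      A 1 = bind₁ ![φ₁, φ₂, X 3] Bh * (pderiv 0 φ₁ * pderiv 2 φ₂ - pderiv 2 φ₁ * pderiv 0 φ₂) ∧
      A 2 = -(bind₁ ![φ₁, φ₂, X 3] Bh *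
        (pderiv 0 φ₁ * pderiv 1 φ₂ - pderiv 1 φ₁ * pderiv 0 φ₂)) := by
    subst hA
    exact ⟨rfl, rfl, rfl⟩
  -- the transport identity for `Bh ∘ Φ`, `Eh ∘ Φ` (closedness of `Φ^*(h dy₀ ∧ dy₁)`)
  have key := transport (φ₁ := φ₁) (φ₂ := φ₂)
    (fun j hj => pderiv_bind₁_three φ₁ φ₂ Bh hj) (fun j hj => pderiv_bind₁_three φ₁ φ₂ Eh hj)
  have hc2 : (Fin.castSucc (2 : Fin (2 + 1)) : Fin (2 + 1 + 1)) = 2 := rfl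
  simp only [Fin.sum_univ_three, Matrix.cons_val_zero, Matrix.cons_val_one, Matrix.cons_val_two,
    Matrix.head_cons, Matrix.tail_cons, Fin.castSucc_zero, Fin.castSucc_one, hc2]
  -- (i) the Griffiths parts sum to zero
  have hsum :
      aeval (Fin.snoc w ϖ₀ : Fin (2 + 1 + 1) → ℝ) (pderiv 0 (A 0) * bind₁ ![φ₁, φ₂, X 3] Eh -
            A 0 * pderiv 0 (bind₁ ![φ₁, φ₂, X 3] Eh)) /
          aeval (Fin.snoc w ϖ₀ : Fin (2 + 1 + 1) → ℝ) (bind₁ ![φ₁, φ₂, X 3] Eh ^ 2) +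
        aeval (Fin.snoc w ϖ₀ : Fin (2 + 1 + 1) → ℝ) (pderiv 1 (A 1) * bind₁ ![φ₁, φ₂, X 3] Eh -
            A 1 * pderiv 1 (bind₁ ![φ₁, φ₂, X 3] Eh)) /
          aeval (Fin.snoc w ϖ₀ : Fin (2 + 1 + 1) → ℝ) (bind₁ ![φ₁, φ₂, X 3] Eh ^ 2) +
        aeval (Fin.snoc w ϖ₀ : Fin (2 + 1 + 1) → ℝ) (pderiv 2 (A 2) * bind₁ ![φ₁, φ₂, X 3] Eh -
            A 2 * pderiv 2 (bind₁ ![φ₁, φ₂, X 3] Eh)) /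
          aeval (Fin.snoc w ϖ₀ : Fin (2 + 1 + 1) → ℝ) (bind₁ ![φ₁, φ₂, X 3] Eh ^ 2) = 0 := by
    rw [← add_div, ← add_div, ← map_add, ← map_add, hA0, hA1, hA2, key, map_zero, zero_div]
  -- (ii) the faces `w₀ ∈ {0,1}` of `A₀/EΦ` and `w₁ ∈ {0,1}` of `A₁/EΦ` vanish
  rw [aeval_A₀_face hι hφ₁ h10 h11 hA0 w ϖ₀ (Or.inr rfl),
    aeval_A₀_face hι hφ₁ h10 h11 hA0 w ϖ₀ (Or.inl rfl),
    aeval_A₁_face hι hφ₂ h20 h21 hA1 w ϖ₀ (Or.inr rfl),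
    aeval_A₁_face hι hφ₂ h20 h21 hA1 w ϖ₀ (Or.inl rfl)]
  -- (iii) the `s`-faces of `A₂/EΦ = −h(Φ_s)·J_s`: `−P/Q` at `s = 1`, `0` at `s = 0`
  have hz : (fun j : Fin 2 => w (Fin.castAdd 1 j)) ∈ KZ.cube 2 :=
    KZ.mem_cube.2 fun j => KZ.mem_cube.1 hw _
  rw [snoc_update_two w 1 ϖ₀, snoc_update_two w 0 ϖ₀, aeval_A₂_one hι hφ₁ hφ₂ hA2,
    aeval_A₂_zero hι hφ₁ hφ₂ hA2, aeval_EΦ_one hι hφ₁ hφ₂, hfib _ hz]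
  linear_combination -hsum

end DescentOfJac2

open DescentOfJac2 in
/-- STUB `stub_descentOfJac2` of line `Sketch` — **the JAC element of dimension 2 inhabits the Tate
descent normal form** (CONSTRUCTOR, `m = 1`, kind (a) only). Data: a Tate family `P/Q` on
`[0,1]² × (ϖ)` whose fibre at the real-algebraic `ϖ₀` is `h(Q₁, Q₂, ϖ₀)·Jac(Q₁, Q₂)` (`hfib`;
`h = Bh/Eh`, `Jac = ∂₀Q₁∂₁Q₂ − ∂₁Q₁∂₀Q₂`), where `Q₁ ≡ κ₁` on both faces `w₀ ∈ {0,1}`, `Q₂ ≡ κ₂`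
on both faces `w₁ ∈ {0,1}` (divisibilities `h10 … h21`) and `Eh(Φ_s(w), ϖ₀) ≠ 0` along the
straight-line family `Φ_s = ((1 − s)κ₁ + sQ₁, (1 − s)κ₂ + sQ₂)`, `s ∈ [0,1]` (`hEh`). Conclusion:
the `∃` block of the research stub `stub_descentTate 0` at `(P, Q, ϖ₀)`, inhabited with one
auxiliary cube variable `s` (`m = 1`), `K = 3` kind-(a) elements and empty kind-(d)/(e) families:
`A = (−BΦ(∂₁φ₁∂₂φ₂ − ∂₂φ₁∂₁φ₂), BΦ(∂₀φ₁∂₂φ₂ − ∂₂φ₁∂₀φ₂), −BΦ·J)` in directions `(w₀, w₁, s)`,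
common denominator `EΦ = Eh ∘ Φ` (`φᵢ = κᵢ + s(Qᵢ − κᵢ)`, `BΦ = Bh ∘ Φ`, `J = s²·Jac`) — the
certificate of `stub_isotopyTwo`. Proof: `EΦ ≠ 0` on `[0,1]³` is `hEh` at `s = w₂`
(`DescentOfJac2.denom_ne`); the identity is `DescentOfJac2.pointwise` (transport identity, face
vanishing, and the `s`-ends `−P/Q`, `0` of `−h(Φ_s)J_s`).
[cite: KontsevichZagier2001, §1.2 rules (2), (3)] [cite: Ayoub2014, Def. 10] -/
theorem stub_descentOfJac2 (P Q : MvPolynomial (Fin (0 + 2 + 1)) ℚ)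
    (Q₁ Q₂ Bh Eh : MvPolynomial (Fin (2 + 1)) ℚ) (κ₁ κ₂ : ℚ)
    (h10 : ∃ R : MvPolynomial (Fin (2 + 1)) ℚ, Q₁ = C κ₁ + X 0 * R)
    (h11 : ∃ R : MvPolynomial (Fin (2 + 1)) ℚ, Q₁ = C κ₁ + (1 - X 0) * R)
    (h20 : ∃ R : MvPolynomial (Fin (2 + 1)) ℚ, Q₂ = C κ₂ + X 1 * R)
    (h21 : ∃ R : MvPolynomial (Fin (2 + 1)) ℚ, Q₂ = C κ₂ + (1 - X 1) * R)
    (ϖ₀ : ℝ) (halg : IsAlgebraic ℚ ϖ₀)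
    (hEh : ∀ w ∈ KZ.cube 2, ∀ s ∈ Icc (0 : ℝ) 1,
      aeval (Fin.snoc (![(1 - s) * κ₁ + s * aeval (Fin.snoc w ϖ₀ : Fin (2 + 1) → ℝ) Q₁,
          (1 - s) * κ₂ + s * aeval (Fin.snoc w ϖ₀ : Fin (2 + 1) → ℝ) Q₂] : Fin 2 → ℝ) ϖ₀ :
        Fin (2 + 1) → ℝ) Eh ≠ 0)
    (hfib : ∀ w ∈ KZ.cube 2,
      aeval (Fin.snoc w ϖ₀ : Fin (0 + 2 + 1) → ℝ) P / aeval (Fin.snoc w ϖ₀ : Fin (0 + 2 + 1) → ℝ) Q =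
        aeval (Fin.snoc (![aeval (Fin.snoc w ϖ₀ : Fin (2 + 1) → ℝ) Q₁,
            aeval (Fin.snoc w ϖ₀ : Fin (2 + 1) → ℝ) Q₂] : Fin 2 → ℝ) ϖ₀ : Fin (2 + 1) → ℝ) Bh /
          aeval (Fin.snoc (![aeval (Fin.snoc w ϖ₀ : Fin (2 + 1) → ℝ) Q₁,
            aeval (Fin.snoc w ϖ₀ : Fin (2 + 1) → ℝ) Q₂] : Fin 2 → ℝ) ϖ₀ : Fin (2 + 1) → ℝ) Eh *
          aeval (Fin.snoc w ϖ₀ : Fin (2 + 1) → ℝ)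
            (pderiv 0 Q₁ * pderiv 1 Q₂ - pderiv 1 Q₁ * pderiv 0 Q₂)) :
    ∃ (m K : ℕ) (A Dn : Fin K → MvPolynomial (Fin (0 + 2 + m + 1)) ℚ) (i : Fin K → Fin (0 + 2 + m))
        (L : ℕ) (B E : Fin L → MvPolynomial (Fin (0 + 2 + m + 1)) ℚ)
        (σ : Fin L → Equiv.Perm (Fin (0 + 2 + m))) (S : Fin L → Finset (Fin (0 + 2 + m)))
        (J : ℕ) (d c : Fin J → ℕ) (e : ∀ j, Fin (d j + c j) ≃ Fin (0 + 2 + m))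
        (Pj Qj : ∀ j, MvPolynomial (Fin (d j + 1)) ℚ) (bj : Fin J → ℝ)
        (Bj Ej : ∀ j, MvPolynomial (Fin (c j + 1)) ℚ),
        (∀ k, ∀ w ∈ KZ.cube (0 + 2 + m), aeval (Fin.snoc w ϖ₀ : Fin (0 + 2 + m + 1) → ℝ) (Dn k) ≠ 0) ∧
        (∀ l, ∀ w ∈ KZ.cube (0 + 2 + m), aeval (Fin.snoc w ϖ₀ : Fin (0 + 2 + m + 1) → ℝ) (E l) ≠ 0) ∧
        (∀ j, d j ≤ 0 + 1) ∧
        (∀ j, ∃ c₀ : ℚ, c₀ ≠ 0 ∧ ∀ y : Fin (d j) → ℝ,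
          aeval (Fin.snoc y (0 : ℝ) : Fin (d j + 1) → ℝ) (Qj j) = (c₀ : ℝ)) ∧
        (∀ j (y : Fin (d j) → ℝ) (ϖ : ℝ), (∀ t, y t ∈ Icc (0 : ℝ) 1) → ϖ ∈ Ioo 0 (bj j) →
          aeval (Fin.snoc y ϖ : Fin (d j + 1) → ℝ) (Qj j) ≠ 0) ∧
        (∀ j, ∀ ϖ ∈ Ioo 0 (bj j), ∫ y in Set.pi Set.univ (fun _ : Fin (d j) => Ioo (0 : ℝ) 1),
          aeval (Fin.snoc y ϖ : Fin (d j + 1) → ℝ) (Pj j) / aeval (Fin.snoc y ϖ : Fin (d j + 1) → ℝ) (Qj j) = 0) ∧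
        (∀ j, ϖ₀ ∈ Ioo 0 (bj j)) ∧
        (∀ j, ∀ y ∈ KZ.cube (c j), aeval (Fin.snoc y ϖ₀ : Fin (c j + 1) → ℝ) (Ej j) ≠ 0) ∧
        (∀ w ∈ KZ.cube (0 + 2 + m),
          aeval (Fin.snoc (fun t => w (Fin.castAdd m t)) ϖ₀ : Fin (0 + 2 + 1) → ℝ) P /
              aeval (Fin.snoc (fun t => w (Fin.castAdd m t)) ϖ₀ : Fin (0 + 2 + 1) → ℝ) Q =
            (∑ k : Fin K,
              (aeval (Fin.snoc w ϖ₀ : Fin (0 + 2 + m + 1) → ℝ)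
                  (pderiv (Fin.castSucc (i k)) (A k) * Dn k - A k * pderiv (Fin.castSucc (i k)) (Dn k)) /
                aeval (Fin.snoc w ϖ₀ : Fin (0 + 2 + m + 1) → ℝ) (Dn k ^ 2)
              - aeval (Fin.snoc (Function.update w (i k) 1) ϖ₀ : Fin (0 + 2 + m + 1) → ℝ) (A k) /
                  aeval (Fin.snoc (Function.update w (i k) 1) ϖ₀ : Fin (0 + 2 + m + 1) → ℝ) (Dn k)
              + aeval (Fin.snoc (Function.update w (i k) 0) ϖ₀ : Fin (0 + 2 + m + 1) → ℝ) (A k) /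
                  aeval (Fin.snoc (Function.update w (i k) 0) ϖ₀ : Fin (0 + 2 + m + 1) → ℝ) (Dn k))) +
            (∑ l : Fin L,
              (aeval (Fin.snoc w ϖ₀ : Fin (0 + 2 + m + 1) → ℝ) (B l) /
                  aeval (Fin.snoc w ϖ₀ : Fin (0 + 2 + m + 1) → ℝ) (E l) -
                aeval (Fin.snoc (fun t => if t ∈ S l then 1 - w (σ l t) else w (σ l t)) ϖ₀ :
                    Fin (0 + 2 + m + 1) → ℝ) (B l) /
                  aeval (Fin.snoc (fun t => if t ∈ S l then 1 - w (σ l t) else w (σ l t)) ϖ₀ :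
                    Fin (0 + 2 + m + 1) → ℝ) (E l))) +
            (∑ j : Fin J,
              aeval (Fin.snoc (fun t => w (e j (Fin.castAdd (c j) t))) ϖ₀ : Fin (d j + 1) → ℝ) (Pj j) /
                  aeval (Fin.snoc (fun t => w (e j (Fin.castAdd (c j) t))) ϖ₀ : Fin (d j + 1) → ℝ) (Qj j) *
                (aeval (Fin.snoc (fun t => w (e j (Fin.natAdd (d j) t))) ϖ₀ : Fin (c j + 1) → ℝ) (Bj j) /
                  aeval (Fin.snoc (fun t => w (e j (Fin.natAdd (d j) t))) ϖ₀ : Fin (c j + 1) → ℝ) (Ej j)))) := by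
  have _ := halg
  -- the re-indexing `ι : ℚ[w₀, w₁, ϖ] → ℚ[w₀, w₁, s, ϖ]` and the certificate data, kept opaque
  obtain ⟨ι, hι⟩ : ∃ ι : Fin (2 + 1) → Fin (2 + 1 + 1), ι = ![0, 1, 3] := ⟨_, rfl⟩
  obtain ⟨φ₁, hφ₁⟩ : ∃ φ : MvPolynomial (Fin (2 + 1 + 1)) ℚ,
      φ = C κ₁ + X 2 * (rename ι Q₁ - C κ₁) := ⟨_, rfl⟩
  obtain ⟨φ₂, hφ₂⟩ : ∃ φ : MvPolynomial (Fin (2 + 1 + 1)) ℚ,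
      φ = C κ₂ + X 2 * (rename ι Q₂ - C κ₂) := ⟨_, rfl⟩
  obtain ⟨BΦ, hBΦ⟩ : ∃ F : MvPolynomial (Fin (2 + 1 + 1)) ℚ, F = bind₁ ![φ₁, φ₂, X 3] Bh :=
    ⟨_, rfl⟩
  obtain ⟨EΦ, hEΦ⟩ : ∃ F : MvPolynomial (Fin (2 + 1 + 1)) ℚ, F = bind₁ ![φ₁, φ₂, X 3] Eh :=
    ⟨_, rfl⟩
  obtain ⟨A, hA⟩ : ∃ A : Fin 3 → MvPolynomial (Fin (2 + 1 + 1)) ℚ,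
      A = ![-(BΦ * (pderiv 1 φ₁ * pderiv 2 φ₂ - pderiv 2 φ₁ * pderiv 1 φ₂)),
        BΦ * (pderiv 0 φ₁ * pderiv 2 φ₂ - pderiv 2 φ₁ * pderiv 0 φ₂),
        -(BΦ * (pderiv 0 φ₁ * pderiv 1 φ₂ - pderiv 1 φ₁ * pderiv 0 φ₂))] := ⟨_, rfl⟩
  obtain ⟨i, hi⟩ : ∃ i : Fin 3 → Fin (2 + 1), i = ![0, 1, 2] := ⟨_, rfl⟩
  refine ⟨1, 3, A, fun _ => EΦ, i, 0, fun l => l.elim0, fun l => l.elim0, fun l => l.elim0,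
    fun l => l.elim0, 0, fun j => j.elim0, fun j => j.elim0, fun j => j.elim0, fun j => j.elim0,
    fun j => j.elim0, fun j => j.elim0, fun j => j.elim0, fun j => j.elim0,
    fun _ w hw => denom_ne hι hφ₁ hφ₂ hEΦ ϖ₀ hEh w hw, fun l => l.elim0, fun j => j.elim0,
    fun j => j.elim0, fun j => j.elim0, fun j => j.elim0, fun j => j.elim0, fun j => j.elim0,
    fun w hw => ?_⟩
  -- the kind-(d) and kind-(e) sums are empty; the kind-(a) sum is `DescentOfJac2.pointwise`
  simp only [Finset.univ_eq_empty, Finset.sum_empty, add_zero]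
  exact pointwise hι hφ₁ hφ₂ hBΦ hEΦ hA hi h10 h11 h20 h21 P Q ϖ₀ hfib w hw

end Summit.KontsevichZagierPeriods.InverseLandau.TateFamilyKernel.Descent
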